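import Summits.AtomisticToContinuum.HydrodynamicLimit.Theorems.CollisionIsometryCLTCollisionalTransferLocalityCcEquilibriumRung
import Summits.AtomisticToContinuum.HydrodynamicLimit.Theorems.CollisionIsometryCLTCollisionalTransferLocalityJumpIncrements
import Summits.AtomisticToContinuum.HydrodynamicLimit.Theorems.CollisionIsometryCLTCollisionalTransferLocalityGridReduction
import Summits.AtomisticToContinuum.HydrodynamicLimit.Theorems.CollisionIsometryCLTCollisionalTransferLocalityBalanceIdentity
import Summits.AtomisticToContinuum.HydrodynamicLimit.Theorems.CollisionIsometryCLTCollisionalTransferLocalityBlockFields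
import Summits.AtomisticToContinuum.HydrodynamicLimit.Theorems.CollisionIsometryCLTCollisionalTransferLocalityFluxForm
import HarnessLib

/-!
# The equilibrium rung of the crux `CollisionalTransferLocality` in `sup_{τ ≤ t}` form, from the
# `sup_τ |Rhs| → 0` statement as a HYPOTHESIS
(line `hemisphere-affine-slaving`, stmt-AtomisticToContinuum-9518, registered stub
`stub_equilibriumSup_of_rhsSup`, [ERc])

This is the re-threading of the landed `stub_equilibriumSup`
(`…CollisionIsometryCLTCollisionalTransferLocalityEquilibriumSup`): the same conclusion — at GLOBAL
EQUILIBRIUM (homogeneous local Gibbs law `G_N` of activity `1`, velocity `0`, temperature `θ`) the crux's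
identity `Cc(τ) = Rhs(τ) + o(1)` holds in probability UNIFORMLY in `τ ∈ [0, t]`, given the window-burst
hypothesis [WB] on the weighted collision virial `V_N = virialW` — but with the statement
`[R] : ∀ θ > 0, ∃ σ₀ > 0, ∀ 0 < σ < σ₀, ∀ Φ t … δ > 0, G_N{∃ τ ∈ [0, t], δ < |Rhs(τ)|} → 0`
(`sup_τ |Rhs| → 0` in probability at constant profiles) as an explicit HYPOTHESIS instead of the route
item `MesoscopicLLN` (from which the landed `rhs_sup_tendsto_zero_const` derives `[R]`).

Proof (assembly of landed lemmas only, verbatim re-threading):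
* [Id0'] `ccRhs_fixedTime_tendsto_zero_of_rhsSup` — at each FIXED `τ ∈ [0, t]`,
  `G_N{δ < |Cc(τ) − Rhs(τ)|} → 0`: union bound of `cc_tendsto_zero_const` (`Cc(τ) → 0`) and `[R]` at
  level `δ/2`;
* on the good set `Cc = J_N` (`stub_balanceIdentity`), `|J_N(τ') − J_N(τ)| ≤ 12 C₁ (V_N(τ') − V_N(τ))`
  for `0 ≤ τ ≤ τ' ≤ t` (`abs_Jfun_sub_Jfun_le`, `C₁` from `exists_grad_bound`), `V_N` is monotone
  (`virialW_mono`), so the grid lemma `exists_grid_index_of_dominated_increments` bounds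
  `|Cc(τ) − Rhs(τ)| ≤ |Cc(τ_k) − Rhs(τ_k)| + 12 C₁ (V_N(τ_{k+1}) − V_N(τ_k)) + δ/3`, `τ_k = kt/n`, as soon
  as `sup_τ |Rhs| ≤ δ/6`;
* the bad event at level `δ` is covered by the null complement of the good set
  (`localGibbsLaw_compl_good'`), the [WB] event at level `δ/(3(12 C₁ + 1))` (probability `≤ ε/3`
  eventually, this fixes `n`), the event `sup_τ |Rhs| > δ/6` (→ 0, by `[R]`) and the `n` grid events
  `|Cc(τ_k) − Rhs(τ_k)| > δ/6` (→ 0 each, by [Id0']); the `ℝ≥0∞` budget is split in three thirds.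
-/

namespace Summit.AtomisticToContinuum.HydrodynamicLimit.Theorems.HemisphereAffineSlaving

open scoped BigOperators Topology Classical ENNReal InnerProductSpace
open Filter Set Function MeasureTheory

noncomputable section

open Literature.MathematicalPhysics.KineticTheory (T3 V3)

/-- A positive `ℝ≥0∞` budget contains a positive real budget. [folklore] -/
private theorem exists_ofReal_le_of_pos_ERc {e : ℝ≥0∞} (he : 0 < e) :
    ∃ e' : ℝ, 0 < e' ∧ ENNReal.ofReal e' ≤ e := by
  rcases eq_or_ne e ⊤ with h | h
  · exact ⟨1, one_pos, h ▸ le_top⟩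
  · refine ⟨e.toReal, ENNReal.toReal_pos he.ne' h, ?_⟩
    rw [ENNReal.ofReal_toReal h]

/-- Union bound behind a null set: if `S ⊆ G ∪ (A ∪ (B ∪ C))` with `μ G = 0` then
`μ S ≤ μ A + (μ B + μ C)`. [folklore] -/
private theorem measure_le_add_three_of_subset_ERc {Ω : Type*} [MeasurableSpace Ω] (μ : Measure Ω)
    {S G A B C : Set Ω} (hG : μ G = 0) (hS : S ⊆ G ∪ (A ∪ (B ∪ C))) :
    μ S ≤ μ A + (μ B + μ C) := by
  calc μ S ≤ μ (G ∪ (A ∪ (B ∪ C))) := measure_mono hS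
    _ ≤ μ G + μ (A ∪ (B ∪ C)) := measure_union_le _ _
    _ ≤ μ G + (μ A + μ (B ∪ C)) := add_le_add le_rfl (measure_union_le _ _)
    _ ≤ μ G + (μ A + (μ B + μ C)) := add_le_add le_rfl (add_le_add le_rfl (measure_union_le _ _))
    _ = μ A + (μ B + μ C) := by rw [hG, zero_add]

/-- [Id0'] **The crux identity at equilibrium at each fixed time, from `sup_τ |Rhs| → 0`.** Given the
statement `[R]` (`sup_{τ ≤ t} |Rhs(τ)| → 0` in probability at constant profiles, for every `θ > 0` below
a `θ`-dependent density radius), for every `θ > 0` there is `σ₀ > 0` such that under the homogeneous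
local Gibbs law (activity `1`, velocity `0`, temperature `θ`) at `0 < σ < σ₀`, for every flow family,
horizon `t > 0`, admissible kernel family, space–time tests smooth on `[0, t]` and FIXED `τ ∈ [0, t]`:
`G_N{δ < |Cc(τ) − Rhs(τ)|} → 0` — `cc_tendsto_zero_const` (`Cc(τ) → 0`) and `[R]` at level `δ/2`,
union bound. [folklore] -/
theorem ccRhs_fixedTime_tendsto_zero_of_rhsSup
    (hR : ∀ θ : ℝ, 0 < θ → ∃ σ₀ : ℝ, 0 < σ₀ ∧ ∀ σ : ℝ, 0 < σ → σ < σ₀ → ∀ (Φ : Flows σ) (t : ℝ),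
      0 < t → ∀ (γ C : ℝ) (φ : ℕ → T3 → ℝ), 0 < γ → γ ≤ 1 / 15 → AdmissibleKernel γ C φ →
      ∀ (ψ : ℝ → T3 → V3) (χ : ℝ → T3 → ℝ),
        Literature.Analysis.FunctionSpaces.Torus.IsSmoothSpaceTimeOn (Icc 0 t) ψ →
        Literature.Analysis.FunctionSpaces.Torus.IsSmoothSpaceTimeOn (Icc 0 t) χ →
      ∀ δ : ℝ, 0 < δ → Tendsto (fun N : ℕ =>
        Literature.MathematicalPhysics.KineticTheory.localGibbsLaw σ (fun _ => 1) (fun _ => 0)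
          (fun _ => θ) N (Φ N) {z | ∃ τ ∈ Icc 0 t, δ < |Rhs σ Φ φ ψ χ N z τ|}) atTop (𝓝 0)) :
    ∀ θ : ℝ, 0 < θ → ∃ σ₀ : ℝ, 0 < σ₀ ∧ ∀ σ : ℝ, 0 < σ → σ < σ₀ → ∀ (Φ : Flows σ) (t : ℝ), 0 < t →
      ∀ (γ C : ℝ) (φ : ℕ → T3 → ℝ), 0 < γ → γ ≤ 1 / 15 → AdmissibleKernel γ C φ →
      ∀ (ψ : ℝ → T3 → V3) (χ : ℝ → T3 → ℝ),
        Literature.Analysis.FunctionSpaces.Torus.IsSmoothSpaceTimeOn (Icc 0 t) ψ →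
        Literature.Analysis.FunctionSpaces.Torus.IsSmoothSpaceTimeOn (Icc 0 t) χ →
      ∀ τ ∈ Icc 0 t, ∀ δ : ℝ, 0 < δ → Tendsto (fun N : ℕ =>
        Literature.MathematicalPhysics.KineticTheory.localGibbsLaw σ (fun _ => 1) (fun _ => 0)
          (fun _ => θ) N (Φ N) {z | δ < |Cc σ Φ ψ χ N z τ - Rhs σ Φ φ ψ χ N z τ|}) atTop (𝓝 0) := by
  intro θ hθ
  obtain ⟨σ₁, hσ₁, H1⟩ := cc_tendsto_zero_const θ hθ
  obtain ⟨σ₂, hσ₂, H2⟩ := hR θ hθ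
  refine ⟨min σ₁ σ₂, lt_min hσ₁ hσ₂, ?_⟩
  intro σ hσ hlt Φ t ht γ C φ hγ hγ' hadm ψ χ hψ hχ τ hτ δ hδ
  have hδ2 : 0 < δ / 2 := half_pos hδ
  have hA := H1 σ hσ (lt_of_lt_of_le hlt (min_le_left _ _)) Φ t ht ψ χ hψ hχ τ hτ (δ / 2) hδ2
  have hB := H2 σ hσ (lt_of_lt_of_le hlt (min_le_right _ _)) Φ t ht γ C φ hγ hγ' hadm ψ χ hψ hχ
    (δ / 2) hδ2
  set P : (N : ℕ) → Measure (Cfg N) := fun N =>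
    Literature.MathematicalPhysics.KineticTheory.localGibbsLaw σ (fun _ => 1) (fun _ => 0) (fun _ => θ)
      N (Φ N) with hP
  have hcover : ∀ N, {z : Cfg N | δ < |Cc σ Φ ψ χ N z τ - Rhs σ Φ φ ψ χ N z τ|} ⊆
      {z | δ / 2 < |Cc σ Φ ψ χ N z τ|} ∪ {z | ∃ τ' ∈ Icc 0 t, δ / 2 < |Rhs σ Φ φ ψ χ N z τ'|} := by
    intro N z hz
    rw [Set.mem_setOf_eq] at hz
    by_contra hno
    simp only [Set.mem_union, Set.mem_setOf_eq, not_or, not_exists, not_and, not_lt] at hno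
    obtain ⟨h1, h2⟩ := hno
    have h3 := h2 τ hτ
    have h4 : |Cc σ Φ ψ χ N z τ - Rhs σ Φ φ ψ χ N z τ| ≤
        |Cc σ Φ ψ χ N z τ| + |Rhs σ Φ φ ψ χ N z τ| := abs_sub _ _
    linarith
  have hsum : Tendsto (fun N => P N {z | δ / 2 < |Cc σ Φ ψ χ N z τ|} +
      P N {z | ∃ τ' ∈ Icc 0 t, δ / 2 < |Rhs σ Φ φ ψ χ N z τ'|}) atTop (𝓝 0) := by
    simpa using hA.add hB
  exact tendsto_of_tendsto_of_tendsto_of_le_of_le tendsto_const_nhds hsum (fun _ => bot_le)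
    fun N => (measure_mono (hcover N)).trans (measure_union_le _ _)

/-- **Registered stub `stub_equilibriumSup_of_rhsSup` ([ERc], the `sup_τ` assembly of the equilibrium
rung of the crux `CollisionalTransferLocality` from the `sup_τ |Rhs| → 0` statement `[R]` as hypothesis,
stmt-AtomisticToContinuum-9518, line hemisphere-affine-slaving).**
Given `[R]`, for every `θ > 0` there is `σ₀ > 0` (`:= min (min σ_[Id0'] σ_[R]) (1/2)`) such that under
the homogeneous local Gibbs law (activity `1`, velocity `0`, temperature `θ`) at `0 < σ < σ₀`, for every
flow family `Φ`, horizon `t > 0` satisfying the window-burst hypothesis [WB] on the weighted collision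
virial, every admissible kernel family and all space–time tests smooth on `[0, t]`:
`sup_{τ ≤ t} |Cc(τ) − Rhs(τ)| → 0` in probability. On the good set `Cc = J_N` (`stub_balanceIdentity`),
`|J_N(τ') − J_N(τ)| ≤ 12 C₁ (V_N(τ') − V_N(τ))` (`abs_Jfun_sub_Jfun_le`, `exists_grad_bound`), `V_N`
monotone (`virialW_mono`); the grid lemma `exists_grid_index_of_dominated_increments` with `R := Rhs`,
modulus `δ/3` (from `sup_τ |Rhs| ≤ δ/6`, `[R]`), `n` from [WB] at level `δ/(3(12 C₁ + 1))`, and the `n`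
grid identities (`ccRhs_fixedTime_tendsto_zero_of_rhsSup`) at level `δ/6`; union bound over the null
complement of the good set (`localGibbsLaw_compl_good'`) and three events of probability `≤ ε/3`.
[folklore] -/
theorem stub_equilibriumSup_of_rhsSup : (∀ θ : ℝ, 0 < θ → ∃ σ₀ : ℝ, 0 < σ₀ ∧ ∀ σ : ℝ, 0 < σ → σ < σ₀ → ∀ (Φ : Flows σ) (t : ℝ), 0 < t → ∀ (γ C : ℝ) (φ : ℕ → T3 → ℝ), 0 < γ → γ ≤ 1 / 15 → AdmissibleKernel γ C φ → ∀ (ψ : ℝ → T3 → V3) (χ : ℝ → T3 → ℝ), Literature.Analysis.FunctionSpaces.Torus.IsSmoothSpaceTimeOn (Icc 0 t) ψ → Literature.Analysis.FunctionSpaces.Torus.IsSmoothSpaceTimeOn (Icc 0 t) χ → ∀ δ : ℝ, 0 < δ → Tendsto (fun N : ℕ => Literature.MathematicalPhysics.KineticTheory.localGibbsLaw σ (fun _ => 1) (fun _ => 0) (fun _ => θ) N (Φ N) {z | ∃ τ ∈ Icc 0 t, δ < |Rhs σ Φ φ ψ χ N z τ|}) atTop (𝓝 0)) → ∀ θ :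 ℝ, 0 < θ → ∃ σ₀ : ℝ, 0 < σ₀ ∧ ∀ σ : ℝ, 0 < σ → σ < σ₀ → ∀ (Φ : Flows σ) (t : ℝ), 0 < t → (∀ δ ε : ℝ, 0 < δ → 0 < ε → ∃ n : ℕ, 0 < n ∧ ∀ᶠ N : ℕ in atTop, Literature.MathematicalPhysics.KineticTheory.localGibbsLaw σ (fun _ => 1) (fun _ => 0) (fun _ => θ) N (Φ N) {z | ∃ k : ℕ, k < n ∧ δ < virialW σ Φ N z ((k + 1) * (t / n)) - virialW σ Φ N z (k * (t / n))} ≤ ENNReal.ofReal ε) → ∀ (γ C : ℝ) (φ : ℕ → T3 → ℝ), 0 < γ → γ ≤ 1 / 15 → AdmissibleKernel γ C φ → ∀ (ψ : ℝ → T3 → V3) (χ : ℝ → T3 → ℝ), Literature.Analysis.FunctionSpaces.Torus.IsSmoothSpaceTimeOn (Icc 0 t) ψ → Literature.Analysis.FunctionSpaces.Torus.IsSmoothSpaceTimeOn (Icc 0 t) χ → ∀ δ : ℝ, 0 < δ → Tendsto (fun N : ℕ => Literature.MathematicalPhysics.KineticTheory.localGibbsLaw σ (fun _ => 1) (fun _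 => 0) (fun _ => θ) N (Φ N) {z | ∃ τ ∈ Icc 0 t, δ < |Cc σ Φ ψ χ N z τ - Rhs σ Φ φ ψ χ N z τ|}) atTop (𝓝 0) := by
  intro hR θ hθ
  obtain ⟨σ₁, hσ₁, H1⟩ := ccRhs_fixedTime_tendsto_zero_of_rhsSup hR θ hθ
  obtain ⟨σ₂, hσ₂, H2⟩ := hR θ hθ
  refine ⟨min (min σ₁ σ₂) (1 / 2), lt_min (lt_min hσ₁ hσ₂) (by norm_num), ?_⟩
  intro σ hσ hlt Φ t ht hWB γ C φ hγ hγ' hadm ψ χ hψ hχ δ hδ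
  have hlt1 : σ < σ₁ := lt_of_lt_of_le hlt ((min_le_left _ _).trans (min_le_left _ _))
  have hlt2 : σ < σ₂ := lt_of_lt_of_le hlt ((min_le_left _ _).trans (min_le_right _ _))
  have hhalf : σ ≤ 1 / 2 := (lt_of_lt_of_le hlt (min_le_right _ _)).le
  have hBal : BalanceFor σ Φ := stub_balanceIdentity σ hσ hhalf Φ
  -- the test fields: a common gradient bound on `[0, t]`, smooth slices
  obtain ⟨C₁, hC₁, hCψ, hCχ⟩ := exists_grad_bound ht hψ hχ
  have hψs : ∀ s ∈ Icc 0 t, ∀ a, Literature.Analysis.FunctionSpaces.Torus.IsSmooth fun y => ψ s y a :=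
    fun s hs a => (hψ.isSmooth_slice hs).apply a
  have hχs : ∀ s ∈ Icc 0 t, Literature.Analysis.FunctionSpaces.Torus.IsSmooth (χ s) :=
    fun s hs => hχ.isSmooth_slice hs
  have hCψ' : ∀ s ∈ Icc 0 t, ∀ a b y, |gradPsi ψ s y a b| ≤ C₁ := fun s hs a b y => hCψ s hs y a b
  -- levels
  have hL0 : 0 ≤ 12 * C₁ := by positivity
  obtain ⟨δV, hδV⟩ : ∃ δV : ℝ, δV = δ / (3 * (12 * C₁ + 1)) := ⟨_, rfl⟩
  have hδV0 : 0 < δV := by rw [hδV]; positivity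
  have hLδV : 12 * C₁ * δV ≤ δ / 3 := by
    have hX : (3 * (12 * C₁ + 1) : ℝ) ≠ 0 := by positivity
    have hkey : 3 * (12 * C₁ + 1) * δV = δ := by rw [hδV]; exact mul_div_cancel₀ δ hX
    nlinarith [hδV0.le, hC₁]
  have hδ6 : 0 < δ / 6 := by positivity
  set P : (N : ℕ) → Measure (Cfg N) := fun N =>
    Literature.MathematicalPhysics.KineticTheory.localGibbsLaw σ (fun _ => 1) (fun _ => 0) (fun _ => θ)
      N (Φ N) with hP
  refine ENNReal.tendsto_nhds_zero.2 fun e he => ?_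
  -- a real budget `e' ≤ e`, split in three thirds; the grid size `n` from [WB]
  obtain ⟨e', he'0, he'e⟩ := exists_ofReal_le_of_pos_ERc he
  have he'3 : 0 < e' / 3 := by positivity
  obtain ⟨n, hn, hWn⟩ := hWB δV (e' / 3) hδV0 he'3
  have hn' : (0 : ℝ) < n := Nat.cast_pos.2 hn
  have hgrid : ∀ k : ℕ, k < n → (k : ℝ) * (t / n) ∈ Icc 0 t := by
    intro k hk
    refine ⟨mul_nonneg k.cast_nonneg (div_pos ht hn').le, ?_⟩
    have hkn : (k : ℝ) ≤ n := by exact_mod_cast hk.le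
    calc (k : ℝ) * (t / n) ≤ n * (t / n) := mul_le_mul_of_nonneg_right hkn (div_pos ht hn').le
      _ = t := mul_div_cancel₀ t hn'.ne'
  -- the three random events
  set A : (N : ℕ) → Set (Cfg N) := fun N =>
    {z | ∃ k : ℕ, k < n ∧ δV < virialW σ Φ N z ((k + 1) * (t / n)) - virialW σ Φ N z (k * (t / n))}
    with hAdef
  set B : (N : ℕ) → Set (Cfg N) := fun N =>
    {z | ∃ τ ∈ Icc 0 t, δ / 6 < |Rhs σ Φ φ ψ χ N z τ|} with hBdef
  set D : (N : ℕ) → ℕ → Set (Cfg N) := fun N k =>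
    {z | δ / 6 < |Cc σ Φ ψ χ N z (k * (t / n)) - Rhs σ Φ φ ψ χ N z (k * (t / n))|} with hDdef
  have hBlim : Tendsto (fun N => P N (B N)) atTop (𝓝 0) :=
    H2 σ hσ hlt2 Φ t ht γ C φ hγ hγ' hadm ψ χ hψ hχ (δ / 6) hδ6
  have hDlim : Tendsto (fun N => ∑ k ∈ Finset.range n, P N (D N k)) atTop (𝓝 0) := by
    have h := tendsto_finsetSum (f := fun k N => P N (D N k)) (a := fun _ => (0 : ℝ≥0∞))
      (Finset.range n) fun k hk =>
        H1 σ hσ hlt1 Φ t ht γ C φ hγ hγ' hadm ψ χ hψ hχ _ (hgrid k (Finset.mem_range.1 hk))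
          (δ / 6) hδ6
    simpa using h
  have h2 : ∀ᶠ N : ℕ in atTop, P N (B N) ≤ ENNReal.ofReal (e' / 3) :=
    ((tendsto_order.1 hBlim).2 _ (ENNReal.ofReal_pos.2 he'3)).mono fun N hN => hN.le
  have h3 : ∀ᶠ N : ℕ in atTop, ∑ k ∈ Finset.range n, P N (D N k) ≤ ENNReal.ofReal (e' / 3) :=
    ((tendsto_order.1 hDlim).2 _ (ENNReal.ofReal_pos.2 he'3)).mono fun N hN => hN.le
  filter_upwards [hWn, h2, h3] with N hN1 hN2 hN3
  -- the union bound at this `N`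
  have hcover : {z : Cfg N | ∃ τ ∈ Icc 0 t, δ < |Cc σ Φ ψ χ N z τ - Rhs σ Φ φ ψ χ N z τ|} ⊆
      (Φ N).goodᶜ ∪ (A N ∪ (B N ∪ ⋃ k ∈ Finset.range n, D N k)) := by
    rintro z ⟨τ, hτ, hzδ⟩
    by_cases hz : z ∈ (Φ N).good
    · right
      by_contra hno
      simp only [Set.mem_union, Set.mem_iUnion, exists_prop, Finset.mem_range, hAdef, hBdef, hDdef,
        Set.mem_setOf_eq, not_or, not_exists, not_and, not_lt] at hno
      obtain ⟨hnA, hnB, hnD⟩ := hno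
      have hmono : MonotoneOn (virialW σ Φ N z) (Icc 0 t) := fun a _ b _ hab =>
        virialW_mono hσ Φ hz hab
      have hJ : ∀ τ τ' : ℝ, 0 ≤ τ → τ ≤ τ' → τ' ≤ t →
          |Jfun σ Φ ψ χ N z τ' - Jfun σ Φ ψ χ N z τ| ≤
            12 * C₁ * (virialW σ Φ N z τ' - virialW σ Φ N z τ) :=
        fun τ τ' h0 h1 h2 => abs_Jfun_sub_Jfun_le hσ hhalf Φ hz hC₁ hψs hχs hCψ' hCχ h0 h1 h2
      have hRm : ∀ τ ∈ Icc 0 t, ∀ τ' ∈ Icc 0 t, |τ' - τ| ≤ t / n →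
          |Rhs σ Φ φ ψ χ N z τ' - Rhs σ Φ φ ψ χ N z τ| ≤ δ / 3 := by
        intro a ha b hb _
        calc |Rhs σ Φ φ ψ χ N z b - Rhs σ Φ φ ψ χ N z a|
            ≤ |Rhs σ Φ φ ψ χ N z b| + |Rhs σ Φ φ ψ χ N z a| := abs_sub _ _
          _ ≤ δ / 6 + δ / 6 := add_le_add (hnB b hb) (hnB a ha)
          _ = δ / 3 := by ring
      obtain ⟨k, hk, hle⟩ := exists_grid_index_of_dominated_increments ht hn hL0
        (Jfun σ Φ ψ χ N z) (virialW σ Φ N z) (Rhs σ Φ φ ψ χ N z) hmono hJ hRm τ hτ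
      have hcj : Cc σ Φ ψ χ N z τ = Jfun σ Φ ψ χ N z τ := hBal N t ht ψ χ hψ hχ z hz τ hτ
      have hcjk : Cc σ Φ ψ χ N z (k * (t / n)) = Jfun σ Φ ψ χ N z (k * (t / n)) :=
        hBal N t ht ψ χ hψ hχ z hz _ (hgrid k hk)
      have hDk := hnD k hk
      have hAk := hnA k hk
      rw [hcjk] at hDk
      rw [hcj] at hzδ
      have hLk : 12 * C₁ * (virialW σ Φ N z ((k + 1) * (t / n)) - virialW σ Φ N z (k * (t / n))) ≤
          δ / 3 := (mul_le_mul_of_nonneg_left hAk hL0).trans hLδV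
      linarith
    · exact Or.inl hz
  calc P N {z | ∃ τ ∈ Icc 0 t, δ < |Cc σ Φ ψ χ N z τ - Rhs σ Φ φ ψ χ N z τ|}
      ≤ P N (A N) + (P N (B N) + P N (⋃ k ∈ Finset.range n, D N k)) :=
        measure_le_add_three_of_subset_ERc _ (by rw [hP]; exact localGibbsLaw_compl_good' (Φ N))
          hcover
    _ ≤ ENNReal.ofReal (e' / 3) + (ENNReal.ofReal (e' / 3) + ENNReal.ofReal (e' / 3)) :=
        add_le_add hN1 (add_le_add hN2
          ((measure_biUnion_finset_le (μ := P N) (Finset.range n) (D N)).trans hN3))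
    _ = ENNReal.ofReal e' := by
        rw [← ENNReal.ofReal_add he'3.le he'3.le, ← ENNReal.ofReal_add he'3.le (by positivity)]
        congr 1; ring
    _ ≤ e := he'e

end

end Summit.AtomisticToContinuum.HydrodynamicLimit.Theorems.HemisphereAffineSlaving
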